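import Summits.BirchSwinnertonDyer.BirchSwinnertonDyer.Theses.PrintX8VSC
import Summits.BirchSwinnertonDyer.BirchSwinnertonDyer.Theorems.SignedLowerHalvesSprungLowerDivisibilityAtThreeIotaDoorContraClosedOfThm714
import Summits.BirchSwinnertonDyer.BirchSwinnertonDyer.Theorems.SignedLowerHalvesSprungLowerDivisibilityAtThreeIotaDoorContraOrbit
import Summits.BirchSwinnertonDyer.BirchSwinnertonDyer.Theorems.SignedLowerHalvesSprungLowerDivisibilityAtThreeStubPeriodMu
import HarnessLib

/-!
# Route `PrintX8VSC`, crux K′ `KatoFineLowerSporadicGivenHeldX8Contra` (item stmt-BirchSwinnertonDyer-23732; parent crux 19875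
# `SprungLowerDivisibilityAtThree`, line `chromatic-common-zeros`): K′ BY NAME ⟺ its guard + the ORBIT RESIDUE — Kato's fine inequality at the
# sporadic common-zero `ι`-orbits on which BOTH members carry positive zeta index exceeding the partner's local index —, and the `(p) ∉ 𝔭`
# antecedent of K′ is REDUNDANT (implied by the common-zero hypothesis and the period unit at `3`)

Cell `bsd-ssimc` (host), width seat `cruxlead-stmt-BirchSwinnertonDyer-19875-w2` (gen 12) under the 19875 LEAD; theorems only (no `def`, no
named fact, no instance); closes NO item (`--supports` stmt-BirchSwinnertonDyer-19875). Sequel of `…IotaDoorContraOrbit` (same seat: in print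
keying `k + j = k′ + j′` on an `ι`-orbit, so residue(𝔭) ⟺ residue(ι𝔭) ⟺ `m < k + k′`) and of LEAD g7's `PrintX8VSCIotaDoorContraOfResidue`
(K′ ⟺ guard → `stub_iotaResidueContra`). Notation at a sporadic height-one `𝔭 ∌ p` for the K′ binders (joint contragredient package `I, Cs, Cf`,
natural-keyed `Y′`): `k = ℓ_𝔭(I.H ⧸ Cs.Z)`, `j = min_• ℓ_𝔭(Λ ⧸ range C•.colMap)`, `x′ = ℓ_𝔭 Y′.X`, `ι𝔭 = PrimeSpectrum.comap (invol p) 𝔭`,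
`k′ = k(ι𝔭)`, `j′ = j(ι𝔭)`.

* §1 `natCast_not_mem_of_commonZero`: over the K′ arithmetic binders, a height-one `𝔭` at which EVERY Néron-normalised colour vanishes does
  not contain `p` — the period unit at `3` (`realPeriodRat_eq_unit_mul_plusPeriod_three`, the guard's third fact) makes `ϖ` a `3`-adic unit, so
  one normalised colour misses every `𝔭 ∋ p` (`ChromaticCommonZeros.stub_periodMu`, THEOREM-B-free: Sprung pairs on X8 have a colour of unit
  content at `(p)` by `IsSprungPair`); hence `katoFineLowerSporadicGivenHeldX8Contra_iff_unguardedP`: **K′ ⟺ K′ with the antecedent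
  `(p : Λ) ∉ 𝔭` deleted** (the vet's «`(p) ∉ 𝔭` load-bearing» (bsd-vet-x8vsc g0, mutation probe) holds for key-free tactics only; given the
  guard it is redundant).
* §2 `katoFineLowerSporadicGivenHeldX8Contra_iff_orbitResidue`: **K′ ⟺ guard → ORBIT RESIDUE**, the orbit residue being the registered
  `stub_iotaResidueContra` with the three FREE consequences of `j′ < k` displayed as extra hypotheses: `j < k′` (the residue at the mirror,
  `ChromaticCommonZeros.iotaResidue_contra_iff_comap_invol`), `1 ≤ k` and `1 ≤ k′`. So the research content of K′ is: Kato 2004 Conj. 12.10 ⊆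
  at the sporadic common-zero `ι`-ORBITS of X8 curves at `p = 3` whose two members BOTH divide the index of Kato's zeta element in `𝐇¹`, with
  total zeta index `k + k′` exceeding the common-zero multiplicity. A text the LEAD may register in place of `stub_iotaResidueContra` (same
  strength, `ι`-symmetric on its face).

HONEST FRAMING: equivalences between typed statements; nothing is discharged; K′, its residue, C′, K1, leaf X8 and BSD are NOT proved; the
guard's facts are printed theorems typed statement-only; conjecturally the residue is EMPTY (no sporadic common zeros: Kurihara–Pollack
Problem 3.2 / Sprung 2015 Conj. 5.6).

References: [Kato2004Asterisque] Conj. 12.10 (p. 224), Thm. 12.4 (p. 221), Thm. 12.6 (p. 222), (17.13.1) (pp. 279–280); [Sprung2012] Def. 6.1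
(p. 1495), Thm. 7.14 (3) (p. 1504), Main Conj. 7.21 (p. 1505); [Sprung2017] Thm. 4.13, Cor. 4.14; [Matar2020] Thm. 1.1; [GreenbergVatsal2000] §3
Rem. 3.4; [KuriharaPollack2007] Problem 3.2; [Sprung2015] Conj. 5.6; tree: `PrintX8VSCIotaDoorContraOfResidue` (LEAD g7), `…IotaDoorContraOrbit`
(this seat), `…StubPeriodMu`.
-/

set_option linter.dupNamespace false
set_option autoImplicit false

noncomputable section

open scoped Classical NumberField MatrixGroups ModularForm

open NumberField IsDedekindDomain CongruenceSubgroup WeierstrassCurve Field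
  Literature.NumberTheory.EllipticCurves Literature.NumberTheory.EllipticCurves.ModularForms
  Literature.NumberTheory.EllipticCurves.ZpExtension Literature.NumberTheory.EllipticCurves.Sprung2017
  Literature.NumberTheory.EllipticCurves.Sprung2012 Literature.NumberTheory.EllipticCurves.Rank1Residual
  Literature.NumberTheory.EllipticCurves.IwasawaAlgebra Literature.NumberTheory.EllipticCurves.Kato2004
  Literature.NumberTheory.EllipticCurves.Module
  Summit.BirchSwinnertonDyer.BirchSwinnertonDyer.Theorems

namespace Summit.BirchSwinnertonDyer.BirchSwinnertonDyer.Theorems.PrintX8VSCIotaDoorContra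

/-! ### §1 The `(p) ∉ 𝔭` antecedent of K′ is redundant -/

/-- **A common zero of every normalised colour never contains `p` (period unit at `3`).** For an X8 pair `(W, p)`, a newform `f` of `W` with
period ratio `ϖ` (`ϖ·Ω_W = Ω⁺_f`), a Sprung pair `(L♯, L♭)` and a height-one `𝔭` of `Λ`: if every Néron-normalised generator of every colour
lies in `𝔭`, then `(p : Λ) ∉ 𝔭` — by `ChromaticCommonZeros.stub_periodMu h3` one normalised colour `G₀` misses every height-one `𝔭 ∋ p`.
[cite: GreenbergVatsal2000, §3, Remark 3.4] [cite: Sprung2012, Def. 6.1 (p. 1495)] [cite: Sprung2017, Thm. 1.12, Cor. 4.14] -/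
theorem natCast_not_mem_of_commonZero (h3 : realPeriodRat_eq_unit_mul_plusPeriod_three) :
    ∀ (W : WeierstrassCurve ℚ) [W.IsElliptic] [W.IsGloballyMinimal] (p : ℕ) [Fact p.Prime],
      ClassX8 W p → ∀ (N : ℕ) (_ : NeZero N) (f : CuspForm (Gamma0 N) 2) (ϖ : ℚ) (Lsharp Lflat : IwasawaAlgebra p),
      IsNewformOf W f → (ϖ : ℝ) * W.realPeriodRat = plusPeriod f →
      IsSprungPair f p (W.frobeniusTrace p) Lsharp Lflat →
    ∀ (𝔭 : PrimeSpectrum (IwasawaAlgebra p)), 𝔭.asIdeal.height = 1 →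
      (∀ (col' : Chroma) (G' : IwasawaAlgebra p),
        iwasawaToPowerSeries p G' =
          PowerSeries.C (ϖ : ℚ_[p]) * iwasawaToPowerSeries p (chromaticL col' Lsharp Lflat) →
        G' ∈ 𝔭.asIdeal) →
      (p : IwasawaAlgebra p) ∉ 𝔭.asIdeal := by
  intro W _ _ p _ hX N hN f ϖ Lsharp Lflat hf hϖ hSP 𝔭 h𝔭 hcommon hp𝔭
  obtain ⟨-, col₀, G₀, hG₀, hmiss⟩ := ChromaticCommonZeros.stub_periodMu h3 W p hX N hN f ϖ Lsharp Lflat hf hϖ hSP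
  exact hmiss 𝔭 h𝔭 hp𝔭 (hcommon col₀ G₀ hG₀)

/-- **K′ ⟺ K′ WITHOUT THE ANTECEDENT `(p : Λ) ∉ 𝔭`.** The right-hand side is the body of `PrintX8VSC.KatoFineLowerSporadicGivenHeldX8Contra` with
the hypothesis `(p : IwasawaAlgebra p) ∉ 𝔭.asIdeal` deleted (so it quantifies over the height-one `𝔭 = (p)` as well — vacuously, by
`natCast_not_mem_of_commonZero` and the guard's period-unit fact). [cite: Kato2004Asterisque, Conj. 12.10 (p. 224)]
[cite: GreenbergVatsal2000, §3, Remark 3.4] [cite: Sprung2012, Def. 6.1 (p. 1495), Thm. 7.14 (3) (p. 1504)] -/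
theorem katoFineLowerSporadicGivenHeldX8Contra_iff_unguardedP :
    Summit.BirchSwinnertonDyer.BirchSwinnertonDyer.Theses.PrintX8VSC.KatoFineLowerSporadicGivenHeldX8Contra ↔
    (thm714_sharpFlatSelmerDual_finite_torsion → thm716_sharpFlatCharIdeal_divisibility_contra →
      realPeriodRat_eq_unit_mul_plusPeriod_three →
      Summit.BirchSwinnertonDyer.BirchSwinnertonDyer.Theses.PrintX8VSC.HeldFactsIotaDoorX8Contra →
      ∀ (W : WeierstrassCurve ℚ) [W.IsElliptic] [W.IsGloballyMinimal] (p : ℕ) [Fact p.Prime]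
      [ContinuousSMul ℤ_[p] (W.tateModule p)] [Module.Free ℤ_[p] (W.tateModule p)]
      [Module.Finite ℤ_[p] (W.tateModule p)],
      ClassX8 W p → ∀ (κ : ZpExtension ℚ p) (γ : Field.absoluteGaloisGroup ℚ),
      κ.IsCyclotomic → κ.IsTopGenerator γ → IsCyclotomicVariable p γ →
      ∀ (v : HeightOneSpectrum (𝓞 ℚ)), (p : 𝓞 ℚ) ∈ v.asIdeal →
      ∀ (g : Field.absoluteGaloisGroup (v.adicCompletion ℚ)),
      κ.IsTopGenerator (resGalOfEmb (closureEmb (K := ℚ) (v.adicCompletion ℚ)) g) →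
      ∀ (cneg : localPoints W (v.adicCompletion ℚ)) (c : ℕ → localPoints W (v.adicCompletion ℚ)),
      IsHondaSystem κ (closureEmb (K := ℚ) (v.adicCompletion ℚ)) W (W.frobeniusTrace p) g cneg c →
      ∀ (N : ℕ) (_ : NeZero N) (f : CuspForm (Gamma0 N) 2) (ϖ : ℚ) (Lsharp Lflat : IwasawaAlgebra p),
      IsNewformOf W f → (ϖ : ℝ) * W.realPeriodRat = plusPeriod f →
      IsSprungPair f p (W.frobeniusTrace p) Lsharp Lflat →
      ∀ (I : Kato2004.IwasawaH1Data W p κ γ)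
      (Cs : SharpFlatColemanKatoDataContra W p f ϖ κ γ (closureEmb (K := ℚ) (v.adicCompletion ℚ))
      (W.frobeniusTrace p) g c Chroma.sharp I)
      (Cf : SharpFlatColemanKatoDataContra W p f ϖ κ γ (closureEmb (K := ℚ) (v.adicCompletion ℚ))
      (W.frobeniusTrace p) g c Chroma.flat I),
      Cs.Z = Cf.Z →
      ∀ (Y : W.FineSelmerDualData κ γ⁻¹) (𝔭 : PrimeSpectrum (IwasawaAlgebra p)), 𝔭.asIdeal.height = 1 →
      (¬ ∃ n : ℕ, ((cyclotomicOmega p n).map (Int.castRingHom ℤ_[p]) : PowerSeries ℤ_[p]) ∈ 𝔭.asIdeal) →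
      (∀ (col' : Chroma) (G' : IwasawaAlgebra p),
      iwasawaToPowerSeries p G' =
      PowerSeries.C (ϖ : ℚ_[p]) * iwasawaToPowerSeries p (chromaticL col' Lsharp Lflat) →
      G' ∈ 𝔭.asIdeal) →
      Module.lengthAt (IwasawaAlgebra p) (I.H ⧸ Cs.Z) 𝔭 ≤ Module.lengthAt (IwasawaAlgebra p) Y.X 𝔭) := by
  constructor
  · intro hK h714 h716c h3 hF W _ _ p _ _ _ _ hX κ γ hκ hγ hcv v hv g hg cneg c hH N hN f ϖ Lsharp Lflat hf hϖ hSP I Cs Cf hZ Y 𝔭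
      h𝔭 hspor hcommon
    exact hK h714 h716c h3 hF W p hX κ γ hκ hγ hcv v hv g hg cneg c hH N hN f ϖ Lsharp Lflat hf hϖ hSP I Cs Cf hZ Y 𝔭 h𝔭
      (natCast_not_mem_of_commonZero h3 W p hX N hN f ϖ Lsharp Lflat hf hϖ hSP 𝔭 h𝔭 hcommon) hspor hcommon
  · intro hU h714 h716c h3 hF W _ _ p _ _ _ _ hX κ γ hκ hγ hcv v hv g hg cneg c hH N hN f ϖ Lsharp Lflat hf hϖ hSP I Cs Cf hZ Y 𝔭
      h𝔭 _ hspor hcommon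
    exact hU h714 h716c h3 hF W p hX κ γ hκ hγ hcv v hv g hg cneg c hH N hN f ϖ Lsharp Lflat hf hϖ hSP I Cs Cf hZ Y 𝔭 h𝔭
      hspor hcommon

/-! ### §2 K′ ⟺ guard → ORBIT residue -/

/-- **K′ ⟺ guard → ORBIT RESIDUE.** Modulo its own guard (Sprung Thm 7.14, Thm 7.16 print-keyed, period unit at 3, the ι-door pack), the crux
`PrintX8VSC.KatoFineLowerSporadicGivenHeldX8Contra` is EQUIVALENT to Kato's fine inequality `k ≤ x′` at the sporadic common zeros `𝔭` lying on
an `ι`-ORBIT OF THE RESIDUE: `j(ι𝔭) < k(𝔭)` (the registered `stub_iotaResidueContra`) AND `j(𝔭) < k(ι𝔭)` (the residue at the mirror) AND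
`1 ≤ k(𝔭)` AND `1 ≤ k(ι𝔭)` — the last three being FREE consequences of the first on class X8 (`ChromaticCommonZeros.iotaResidue_contra_iff_comap_invol`:
`k + j` is `ι`-symmetric in print keying; normalised generators from `stub_periodMu`). So K′'s research content lives on the common-zero
`ι`-orbits whose two members BOTH divide the index of Kato's zeta element, with total zeta index exceeding the common-zero multiplicity.
[cite: Kato2004Asterisque, Conj. 12.10 (p. 224), Thm. 12.4 (p. 221), Thm. 12.6 (p. 222), (17.13.1) (pp. 279–280)] [cite: Sprung2012, Thm. 7.14 (3) (p. 1504)]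
[cite: Sprung2017, Thm. 4.13, Cor. 4.14] [cite: Matar2020, Thm. 1.1] [cite: KuriharaPollack2007, Problem 3.2] -/
theorem katoFineLowerSporadicGivenHeldX8Contra_iff_orbitResidue :
    Summit.BirchSwinnertonDyer.BirchSwinnertonDyer.Theses.PrintX8VSC.KatoFineLowerSporadicGivenHeldX8Contra ↔
    (thm714_sharpFlatSelmerDual_finite_torsion → thm716_sharpFlatCharIdeal_divisibility_contra →
      realPeriodRat_eq_unit_mul_plusPeriod_three →
      Summit.BirchSwinnertonDyer.BirchSwinnertonDyer.Theses.PrintX8VSC.HeldFactsIotaDoorX8Contra →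
      ∀ (W : WeierstrassCurve ℚ) [W.IsElliptic] [W.IsGloballyMinimal] (p : ℕ) [Fact p.Prime]
      [ContinuousSMul ℤ_[p] (W.tateModule p)] [Module.Free ℤ_[p] (W.tateModule p)]
      [Module.Finite ℤ_[p] (W.tateModule p)],
      ClassX8 W p → ∀ (κ : ZpExtension ℚ p) (γ : Field.absoluteGaloisGroup ℚ),
      κ.IsCyclotomic → κ.IsTopGenerator γ → IsCyclotomicVariable p γ →
      ∀ (v : HeightOneSpectrum (𝓞 ℚ)), (p : 𝓞 ℚ) ∈ v.asIdeal →
      ∀ (g : Field.absoluteGaloisGroup (v.adicCompletion ℚ)),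
      κ.IsTopGenerator (resGalOfEmb (closureEmb (K := ℚ) (v.adicCompletion ℚ)) g) →
      ∀ (cneg : localPoints W (v.adicCompletion ℚ)) (c : ℕ → localPoints W (v.adicCompletion ℚ)),
      IsHondaSystem κ (closureEmb (K := ℚ) (v.adicCompletion ℚ)) W (W.frobeniusTrace p) g cneg c →
      ∀ (N : ℕ) (_ : NeZero N) (f : CuspForm (Gamma0 N) 2) (ϖ : ℚ) (Lsharp Lflat : IwasawaAlgebra p),
      IsNewformOf W f → (ϖ : ℝ) * W.realPeriodRat = plusPeriod f →
      IsSprungPair f p (W.frobeniusTrace p) Lsharp Lflat →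
      ∀ (I : Kato2004.IwasawaH1Data W p κ γ)
      (Cs : SharpFlatColemanKatoDataContra W p f ϖ κ γ (closureEmb (K := ℚ) (v.adicCompletion ℚ))
      (W.frobeniusTrace p) g c Chroma.sharp I)
      (Cf : SharpFlatColemanKatoDataContra W p f ϖ κ γ (closureEmb (K := ℚ) (v.adicCompletion ℚ))
      (W.frobeniusTrace p) g c Chroma.flat I),
      Cs.Z = Cf.Z →
      ∀ (Y : W.FineSelmerDualData κ γ⁻¹) (𝔭 : PrimeSpectrum (IwasawaAlgebra p)), 𝔭.asIdeal.height = 1 →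
      (p : IwasawaAlgebra p) ∉ 𝔭.asIdeal →
      (¬ ∃ n : ℕ, ((cyclotomicOmega p n).map (Int.castRingHom ℤ_[p]) : PowerSeries ℤ_[p]) ∈ 𝔭.asIdeal) →
      (∀ (col' : Chroma) (G' : IwasawaAlgebra p),
      iwasawaToPowerSeries p G' =
      PowerSeries.C (ϖ : ℚ_[p]) * iwasawaToPowerSeries p (chromaticL col' Lsharp Lflat) →
      G' ∈ 𝔭.asIdeal) →
      -- the registered residue: deficient local index at the mirror prime, `j(ι𝔭) < k(𝔭)`
      min (Module.lengthAt (IwasawaAlgebra p) (IwasawaAlgebra p ⧸ LinearMap.range Cs.colMap)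
      (PrimeSpectrum.comap (invol p).toRingHom 𝔭))
      (Module.lengthAt (IwasawaAlgebra p) (IwasawaAlgebra p ⧸ LinearMap.range Cf.colMap)
      (PrimeSpectrum.comap (invol p).toRingHom 𝔭)) <
      Module.lengthAt (IwasawaAlgebra p) (I.H ⧸ Cs.Z) 𝔭 →
      -- FREE: the residue at the mirror, `j(𝔭) < k(ι𝔭)`
      min (Module.lengthAt (IwasawaAlgebra p) (IwasawaAlgebra p ⧸ LinearMap.range Cs.colMap) 𝔭)
      (Module.lengthAt (IwasawaAlgebra p) (IwasawaAlgebra p ⧸ LinearMap.range Cf.colMap) 𝔭) <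
      Module.lengthAt (IwasawaAlgebra p) (I.H ⧸ Cs.Z) (PrimeSpectrum.comap (invol p).toRingHom 𝔭) →
      -- FREE: both members of the orbit carry zeta index
      1 ≤ Module.lengthAt (IwasawaAlgebra p) (I.H ⧸ Cs.Z) 𝔭 →
      1 ≤ Module.lengthAt (IwasawaAlgebra p) (I.H ⧸ Cs.Z) (PrimeSpectrum.comap (invol p).toRingHom 𝔭) →
      Module.lengthAt (IwasawaAlgebra p) (I.H ⧸ Cs.Z) 𝔭 ≤ Module.lengthAt (IwasawaAlgebra p) Y.X 𝔭) := by
  constructor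
  · intro hK h714 h716c h3 hF W _ _ p _ _ _ _ hX κ γ hκ hγ hcv v hv g hg cneg c hH N hN f ϖ Lsharp Lflat hf hϖ hSP I Cs Cf hZ Y 𝔭
      h𝔭 hp𝔭 hspor hcommon _ _ _ _
    exact hK h714 h716c h3 hF W p hX κ γ hκ hγ hcv v hv g hg cneg c hH N hN f ϖ Lsharp Lflat hf hϖ hSP I Cs Cf hZ Y 𝔭 h𝔭 hp𝔭
      hspor hcommon
  · intro horb h714 h716c h3 hF W _ _ p _ _ _ _ hX κ γ hκ hγ hcv v hv g hg cneg c hH N hN f ϖ Lsharp Lflat hf hϖ hSP I Cs Cf hZ Y 𝔭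
      h𝔭 hp𝔭 hspor hcommon
    -- door ∨ residue (`le_or_gt` on `ℕ∞`), exactly as the registered skeleton's composition
    rcases le_or_gt (Module.lengthAt (IwasawaAlgebra p) (I.H ⧸ Cs.Z) 𝔭)
        (min (Module.lengthAt (IwasawaAlgebra p) (IwasawaAlgebra p ⧸ LinearMap.range Cs.colMap)
              (PrimeSpectrum.comap (invol p).toRingHom 𝔭))
          (Module.lengthAt (IwasawaAlgebra p) (IwasawaAlgebra p ⧸ LinearMap.range Cf.colMap)
              (PrimeSpectrum.comap (invol p).toRingHom 𝔭))) with hle | hlt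
    · exact ChromaticCommonZeros.iotaDoorContra_sporadic_of_heldPack_of_thm714 hF.1 hF.2.1 hF.2.2 h714 W p hX κ γ hκ hγ hcv v hv g
        hg cneg c hH N hN f ϖ Lsharp Lflat hf hϖ hSP I Cs Cf hZ Y 𝔭 h𝔭 hp𝔭 hspor hcommon hle
    haveI : NeZero N := hN
    obtain ⟨hs0, hf0⟩ :=
      ChromaticBothColours.ClassX8.sharp_ne_zero_and_flat_ne_zero W p hX N inferInstance f Lsharp Lflat hf hSP
    obtain ⟨hG, -⟩ := ChromaticCommonZeros.stub_periodMu h3 W p hX N hN f ϖ Lsharp Lflat hf hϖ hSP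
    obtain ⟨Gs, hGs⟩ := hG Chroma.sharp
    obtain ⟨Gf, hGf⟩ := hG Chroma.flat
    have hlt' := (ChromaticCommonZeros.iotaResidue_contra_iff_comap_invol W p Cs Cf hZ (ClassX8.irr' W p hX)
      (hf.periodRatio_ne_zero hϖ) hSP hs0 hf0 hGs hGf (ChromaticCommonZeros.ClassX8.invol_mem_span_pair W p hX f Lsharp Lflat hf hSP)
      𝔭 h𝔭 hp𝔭).mp hlt
    exact horb h714 h716c h3 hF W p hX κ γ hκ hγ hcv v hv g hg cneg c hH N hN f ϖ Lsharp Lflat hf hϖ hSP I Cs Cf hZ Y 𝔭 h𝔭 hp𝔭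
      hspor hcommon hlt hlt' (Order.one_le_iff_pos.mpr (lt_of_le_of_lt bot_le hlt))
      (Order.one_le_iff_pos.mpr (lt_of_le_of_lt bot_le hlt'))

end Summit.BirchSwinnertonDyer.BirchSwinnertonDyer.Theorems.PrintX8VSCIotaDoorContra

end
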